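import Summits.QuantumFields.BalabanUV.Beta.EriceRemainderEnclosureHistoryAutonomyComparisonAgeCompositionChainWiringTerms
import Summits.QuantumFields.BalabanUV.Beta.EriceRemainderEnclosureHistoryAutonomyComparisonAgeCompositionMonoYoungest

/-!
# EriceRemainderEnclosureHistoryAutonomyComparisonAgeCompositionOneLagDecayFlow — (E81b) «THE LOAD FORCES ITS OWN DECAY», PROVED ALONG EVERY BOX
# SOLUTION: the one-lag young kernel `Kk_m = (L_1h_{m+1}³∕2)·g_{m+1}` of the youngest age satisfies **`Kk_{m+1}(1 + Kk_m) ≤ Kk_m`** for EVERY isotone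
# memory with floor dominated by ANY profile `L ≥ 0` and EVERY damping in the relaxed class `1∕(1+F_t) ≤ g_t ≤ 1` — hence (E80g)'s MONO″ for the lone
# youngest age is a theorem about the flow, and route (N)'s first-order END holds WITH NO MONOTONICITY HYPOTHESIS for the single-age profile (`K = 2`)

Cell `pub-balaban`, β-function sub-cell, BINDER row D4 «RemainderConst leaves for Bałaban's split» (`HOME/BINDER-OWNERS.md`; owner lineage `b2b-balaban-beta-an4`;
this file by co-owner #2 lineage `b2b-balaban-beta-d4-p2`, generation 72), β-FLOW TEAM duty (1), FREEZE (0) honoured (def-free; imports (E80f)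
`…ChainWiringTerms`, (E80g) `…MonoYoungest`; uses `increment_anti` (E58b), `strictAnti_of_memFlow` (E48a), `flow_nonneg_of_mono2`,
`one_lag_young_drops_antitone` BY NAME; nothing restated).

HONEST FRAMING (page 1, verbatim and binding).  *"Discharging BetaPertH makes Bałaban's UV stability UNCONDITIONAL — a real constructive-QFT result; it is
NOT the continuum limit and NOT the Clay problem."*  THIS FILE DISCHARGES NOTHING OF THE KIND.  Elementary real analysis about ABSTRACT functionals on a box
]0,γ]^ℕ with displayed floors, profiles and signs, and the FIRST-ORDER renewal objects of route (N) built from them — hypotheses of a census, not facts; the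
form, signs, ages and moments of Bałaban's (1.22) limit functional are NOT PRINTED ([I] p. 298; GAPS G-t4-U2-1∕-2) and NOT asserted.  Row D4 class
UNCHANGED (critical-path width 0; instance 0∕1; D4 DISCHARGE NO DATE).  HONEST DEPENDENCY: continuum YM on T⁴ ⇐ BetaPertH ∧ nine spine estimates (0/9
proved); BetaPertH ⇐ (D1) ∧ (D4) ∧ CAP+tail; G-an2-4 gates asym, D1 and NE2/3/4.

THE POINT (census sense (α); route (N); README `g71/e80` §4 (2)(i) and this station's `g72/e81/README.md`).  (E80g) reduced MONO″ for the lone youngest age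
to ONE inequality on its kernel, `Kk_{m+1}(1 + Kk_m) ≤ Kk_m`, and left it as a hypothesis with toy evidence.  THIS FILE PROVES IT FOR THE FLOW, in the
generality of (E80f): `B` isotone with floor `b > 0` dominated by `L ≥ 0` on the ages `< K` (ANY other ages present), `h` a box solution, `g` ANY damping
with `1∕(1 + F_t) ≤ g_t ≤ 1`, `F_t = Σ_{k<K} L_kh_{t+k}³∕2`.  MECHANISM (`g72/numerics/m3.py`–`m6.py`): the kernel of EVERY age decays per pin at the rate of
`h³` one scale deeper, `c_{m,1}∕c_{m+1,1} = (h_{m+1}∕h_{m+2})³ = r³`, and the level increment that drives it dominates the WHOLE damping load one pin deeper: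
`c′ = c_{m+1,1}`, `F = F_{m+1}`: **`r² − 1 = h_{m+1}²·B(h(m+2+·)) ≥ 2c′r + 2(F − c′)∕r`** (`level_step_ge`: domination `B ≥ Σ L_ku_k`, ratio monotonicity
`h_{m+2+k}∕h_{m+1+k} ≥ h_{m+2}∕h_{m+1}` of the log-concave `1∕h` — `ratio_step_mono`, from the concavity of the levels (E58b) `increment_anti` —, and
`h_{m+3}h_{m+1} ≥ h_{m+2}²` for the age-1 term); concavity also gives `r² ≤ 2`; and `one_lag_poly`: `1 ≤ r ≤ 2`, `c′ ≤ F`, `r³ − r ≥ 2c′r² + 2(F − c′)` ⟹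
`r³(1 − c′) ≥ 1 + F` (⟸ `(r−1)(−r⁴+r³+2r²+r−1) ≥ 0`).  Then `c′g_{m+2}(1 + cg_{m+1}) ≤ c′(1 + cg_{m+1}) ≤ cg_{m+1}` since `g_{m+1}(1+F) ≥ 1`, `c = c′r³`.
No smallness, no affinity of `B`, no self-consistency of `g` (`m4.py`: relative margin factor ≈ 1.5 at deep pins in the relaxed class, ≈ 3 self-consistent).
CONSEQUENCES: §4 in (E80e)'s `KL` letters; §5 **`flow_nonneg_two`** — (E80f) `flow_nonneg_of_mono2` for `K = 2` (the lone age `1`; `SA 2 = id`, `RA 2 = 0`)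
with `hMONOa` vacuous and `hMONO2` = (E80g) fed by §4: THE FIRST INSTANCE OF ROUTE (N)'s FIRST-ORDER END WITH NO MONOTONICITY HYPOTHESIS (positivity
itself is trivial for one lag — the point is that the (N)-machine closes on it).  With older ages present, MONO″ for the youngest age ⟸ KEY₁ ∧ «the old
surplus grows per pin no faster than the one-lag decay ratio» — (E81c), via (E81a).  NOT CLAIMED: MONO″ for windows `y ≥ 2` or MONOa for the flow;
anything nonlinear; anything printed.

WHAT IS PROVED ([folklore]; 0 `def`, 0 sorry).  §1 `log_concave_flow`, `ratio_step_mono`, `sq_le_two_mul_sq`.  §2 `one_lag_poly`.  §3 `level_step_ge`,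
**`one_lag_decay_flow`**, `young_coeff_le`.  §4 `kernel_one_lag_decay`, `kernel_one_lag_le_one`.  §5 **`flow_nonneg_two`**.
-/
noncomputable section
open Finset

namespace Summit.QuantumFields.BalabanUV.Beta.EriceRemainderEnclosureHistoryAutonomyComparisonAgeCompositionOneLagDecayFlow

open Literature.MathematicalPhysics.QuantumFieldTheory.Balaban1983to89
open Literature.MathematicalPhysics.QuantumFieldTheory.Balaban1983to89.T4BetaStationary
open Literature.MathematicalPhysics.QuantumFieldTheory.Balaban1983to89.T4BetaFlowWellPosed
open Summit.QuantumFields.BalabanUV.Beta.EriceRemainderEnclosureHistoryAutonomyOrder (strictAnti_of_memFlow)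
open Summit.QuantumFields.BalabanUV.Beta.EriceRemainderEnclosureHistoryAutonomyComparisonAffineProfile (increment_anti)
open Summit.QuantumFields.BalabanUV.Beta.EriceRemainderEnclosureHistoryAutonomyComparisonAgeCompositionInduction (aggregate_sol_top)
open Summit.QuantumFields.BalabanUV.Beta.EriceRemainderEnclosureHistoryAutonomyComparisonAgeCompositionChainWiringTerms (flow_nonneg_of_mono2)
open Summit.QuantumFields.BalabanUV.Beta.EriceRemainderEnclosureHistoryAutonomyComparisonAgeCompositionMonoYoungest (one_lag_young_drops_antitone)

variable {B : (ℕ → ℝ) → ℝ} {γ b gIR : ℝ} {L : ℕ → ℝ} {K : ℕ} {h g : ℕ → ℝ}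

/-! ## §1 Level geometry of an isotone memory: log-concavity of `1∕h`, monotone one-step ratios, `a_{m+2} ≤ 2a_{m+1}` -/

/-- **LOG-CONCAVITY OF `1∕h`** along a box solution of an isotone memory with floor: `h_{n+1}² ≤ h_{n+2}·h_n` (from the concavity of the levels
`a_{n+2} + a_n ≤ 2a_{n+1}`, `a = 1∕h²`, and `a_{n+2}a_n ≤ ((a_{n+2}+a_n)∕2)²`). [folklore] -/
theorem log_concave_flow (hmono : ∀ u v : ℕ → ℝ, SeqBox γ u → SeqBox γ v → (∀ j, u j ≤ v j) → B u ≤ B v) (hb : 0 < b)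
    (hlo : ∀ u, SeqBox γ u → b ≤ B u) (hh : SeqBox γ h) (hf : MemFlow B gIR h) (n : ℕ) :
    h (n + 1) ^ 2 ≤ h (n + 2) * h n := by
  have hinc := increment_anti hmono hb hlo hh hf (Nat.le_succ n)
  have e0 := hf.2 n
  have e1 := hf.2 (n + 1)
  have h0 := (hh n).1; have h1 := (hh (n + 1)).1; have h2 := (hh (n + 2)).1
  -- a_{n+2} + a_n ≤ 2 a_{n+1}
  have hconc : 1 / h (n + 2) ^ 2 + 1 / h n ^ 2 ≤ 2 * (1 / h (n + 1) ^ 2) := by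
    have : (n + 1 + 1 : ℕ) = n + 2 := by ring
    rw [this] at e1
    linarith
  -- clear denominators: h_{n+1}²(h_n² + h_{n+2}²) ≤ 2 h_{n+2}² h_n², then AM-GM
  have key : h (n + 1) ^ 2 * (h n ^ 2 + h (n + 2) ^ 2) ≤ 2 * (h (n + 2) ^ 2 * h n ^ 2) := by
    have e : 1 / h (n + 2) ^ 2 + 1 / h n ^ 2 = (h n ^ 2 + h (n + 2) ^ 2) / (h (n + 2) ^ 2 * h n ^ 2) := by
      field_simp
    have e2 : 2 * (1 / h (n + 1) ^ 2) = 2 / h (n + 1) ^ 2 := by ring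
    rw [e, e2, div_le_div_iff₀ (by positivity) (by positivity)] at hconc
    linarith
  have amgm : 2 * (h n * h (n + 2)) ≤ h n ^ 2 + h (n + 2) ^ 2 := by nlinarith [sq_nonneg (h n - h (n + 2))]
  have h3 : h (n + 1) ^ 2 * (2 * (h n * h (n + 2))) ≤ 2 * (h (n + 2) ^ 2 * h n ^ 2) :=
    (mul_le_mul_of_nonneg_left amgm (sq_nonneg _)).trans key
  have h4 : (2 * (h n * h (n + 2))) * h (n + 1) ^ 2 ≤ (2 * (h n * h (n + 2))) * (h (n + 2) * h n) := by nlinarith [h3]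
  exact le_of_mul_le_mul_left h4 (by positivity)

/-- **THE ONE-STEP RATIOS `h_{n+1}∕h_n` ARE NON-DECREASING**: `h_{n+1}·h_{n+k} ≤ h_n·h_{n+1+k}` for every lag `k` (log-concavity transported). [folklore] -/
theorem ratio_step_mono (hmono : ∀ u v : ℕ → ℝ, SeqBox γ u → SeqBox γ v → (∀ j, u j ≤ v j) → B u ≤ B v) (hb : 0 < b)
    (hlo : ∀ u, SeqBox γ u → b ≤ B u) (hh : SeqBox γ h) (hf : MemFlow B gIR h) (n k : ℕ) :
    h (n + 1) * h (n + k) ≤ h n * h (n + 1 + k) := by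
  induction k with
  | zero => simp [mul_comm]
  | succ k ih =>
    have hlc := log_concave_flow hmono hb hlo hh hf (n + k)
    have hA := (hh (n + k)).1; have hB := (hh (n + 1 + k)).1; have hC := (hh (n + k + 2)).1
    have e1 : h (n + k + 1) = h (n + 1 + k) := by ring_nf
    rw [e1] at hlc
    rw [show n + (k + 1) = n + 1 + k by ring, show n + 1 + (k + 1) = n + k + 2 by ring]
    -- h(n+1) h(n+1+k) · h(n+1+k) h(n+k) ≤ h n h(n+1+k) · h(n+k+2) h(n+k); cancel h(n+1+k) h(n+k) > 0
    have key : (h (n + 1) * h (n + 1 + k)) * (h (n + 1 + k) * h (n + k)) ≤ (h n * h (n + k + 2)) * (h (n + 1 + k) * h (n + k)) := by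
      calc (h (n + 1) * h (n + 1 + k)) * (h (n + 1 + k) * h (n + k)) = (h (n + 1) * h (n + k)) * h (n + 1 + k) ^ 2 := by ring
        _ ≤ (h n * h (n + 1 + k)) * (h (n + k + 2) * h (n + k)) :=
            mul_le_mul ih hlc (pow_nonneg hB.le 2) (mul_nonneg (hh n).1.le hB.le)
        _ = (h n * h (n + k + 2)) * (h (n + 1 + k) * h (n + k)) := by ring
    exact le_of_mul_le_mul_right key (mul_pos hB hA)

/-- `a_{m+2} ≤ 2a_{m+1}`: `h_{m+1}² ≤ 2·h_{m+2}²` (concavity of the levels and `a_m ≥ 0`). [folklore] -/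
theorem sq_le_two_mul_sq (hmono : ∀ u v : ℕ → ℝ, SeqBox γ u → SeqBox γ v → (∀ j, u j ≤ v j) → B u ≤ B v) (hb : 0 < b)
    (hlo : ∀ u, SeqBox γ u → b ≤ B u) (hh : SeqBox γ h) (hf : MemFlow B gIR h) (m : ℕ) :
    h (m + 1) ^ 2 ≤ 2 * h (m + 2) ^ 2 := by
  have hinc := increment_anti hmono hb hlo hh hf (Nat.le_succ m)
  have e0 := hf.2 m
  have e1 := hf.2 (m + 1)
  have h0 := (hh m).1; have h1 := (hh (m + 1)).1; have h2 := (hh (m + 2)).1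
  have ha0 : 0 ≤ 1 / h m ^ 2 := by positivity
  have hconc : 1 / h (m + 2) ^ 2 ≤ 2 * (1 / h (m + 1) ^ 2) := by
    have : (m + 1 + 1 : ℕ) = m + 2 := by ring
    rw [this] at e1
    linarith
  rw [show 2 * (1 / h (m + 1) ^ 2) = 1 / (h (m + 1) ^ 2 / 2) by field_simp,
    one_div_le_one_div (by positivity) (by positivity)] at hconc
  linarith

/-! ## §2 The polynomial fact -/

/-- **THE ONE-LAG POLYNOMIAL FACT.**  `1 ≤ r ≤ 2`, `c′ ≤ F`, `2c′r² + 2(F − c′) ≤ r³ − r` ⟹ `1 + F ≤ r³(1 − c′)`.  (Eliminate `F`; the remaining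
`c′(2r³ − 2r² + 2) ≤ r³ + r − 2` follows from `c′ ≤ (r³−r)∕(2r²)` and `(r − 1)(−r⁴ + r³ + 2r² + r − 1) ≥ 0` on `[1,2]`.) [folklore] -/
theorem one_lag_poly {r c F : ℝ} (hr1 : 1 ≤ r) (hr2 : r ≤ 2) (hcF : c ≤ F)
    (hflow : 2 * c * r ^ 2 + 2 * (F - c) ≤ r ^ 3 - r) : 1 + F ≤ r ^ 3 * (1 - c) := by
  have hc1 : 2 * c * r ^ 2 ≤ r ^ 3 - r := by nlinarith
  have hQ : 0 ≤ -r ^ 4 + r ^ 3 + 2 * r ^ 2 + r - 1 := by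
    nlinarith [mul_nonneg (mul_nonneg (by linarith : (0:ℝ) ≤ r - 1) (by linarith : (0:ℝ) ≤ 2 - r)) (by positivity : (0:ℝ) ≤ r ^ 2)]
  have hP : (r ^ 3 - r) * (2 * r ^ 3 - 2 * r ^ 2 + 2) ≤ (r ^ 3 + r - 2) * (2 * r ^ 2) := by
    nlinarith [mul_nonneg (by linarith : (0:ℝ) ≤ r - 1) hQ]
  have hpos : 0 < 2 * r ^ 3 - 2 * r ^ 2 + 2 := by nlinarith
  have hc2 : c * (2 * r ^ 3 - 2 * r ^ 2 + 2) ≤ r ^ 3 + r - 2 := by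
    have h2r : 0 < 2 * r ^ 2 := by positivity
    have := mul_le_mul_of_nonneg_right hc1 hpos.le
    nlinarith
  nlinarith

/-! ## §3 The one-lag decay along the flow -/

/-- **THE LEVEL STEP DOMINATES THE DAMPING LOAD ONE PIN DEEPER.**  With `r = h_{m+1}∕h_{m+2}`, `c′ = L_1h_{m+2}³∕2`, `F = Σ_{k<K} L_kh_{m+1+k}³∕2`
(`1 < K`): **`2c′r² + 2(F − c′) ≤ r³ − r`**, i.e. `r² − 1 = h_{m+1}²·B(h(m+2+·)) ≥ 2c′r + 2(F−c′)∕r` — domination `B ≥ Σ_k L_ku_k`, the age-1 term through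
`h_{m+3}h_{m+1} ≥ h_{m+2}²`, every term through `h_{m+2+k}∕h_{m+1+k} ≥ h_{m+2}∕h_{m+1}` and `h_{m+1+k} ≤ h_{m+1}`. [folklore] -/
theorem level_step_ge (hmono : ∀ u v : ℕ → ℝ, SeqBox γ u → SeqBox γ v → (∀ j, u j ≤ v j) → B u ≤ B v) (hL : ∀ k, 0 ≤ L k) (hb : 0 < b)
    (hlo : ∀ u, SeqBox γ u → b ≤ B u) (hdom : ∀ u, SeqBox γ u → ∑ k ∈ range K, L k * u k ≤ B u)
    (hh : SeqBox γ h) (hf : MemFlow B gIR h) (hK : 1 < K) (m : ℕ) :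
    2 * (L 1 * h (m + 2) ^ 3 / 2) * (h (m + 1) / h (m + 2)) ^ 2 + 2 * (∑ k ∈ range K, L k * h (m + 1 + k) ^ 3 / 2 - L 1 * h (m + 2) ^ 3 / 2)
      ≤ (h (m + 1) / h (m + 2)) ^ 3 - h (m + 1) / h (m + 2) := by
  have hpos : ∀ n, 0 < h n := fun n => (hh n).1
  have hanti := (strictAnti_of_memFlow hb hlo hh hf).antitone
  have h1 := hpos (m + 1); have h2 := hpos (m + 2); have h3 := hpos (m + 3)
  -- the level step
  have e1 : 1 / h (m + 2) ^ 2 = 1 / h (m + 1) ^ 2 + B (fun j => h (m + 2 + j)) := by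
    have := hf.2 (m + 1); rwa [show m + 1 + 1 = m + 2 by ring] at this
  have hdomB : ∑ k ∈ range K, L k * h (m + 2 + k) ≤ B (fun j => h (m + 2 + j)) := hdom _ (seqBox_shift hh (m + 2))
  -- termwise: h(m+1)² L_k h(m+2+k) ≥ 2 (L_k h(m+1+k)³/2) (h(m+2)/h(m+1)), and for k = 1 the sharper ≥ 2 c′ (h(m+1)/h(m+2))
  have hterm : ∀ k, (L k * h (m + 1 + k) ^ 3 / 2) * (h (m + 2) / h (m + 1)) ≤ h (m + 1) ^ 2 * (L k * h (m + 2 + k)) / 2 := by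
    intro k
    have hk1 := hpos (m + 1 + k); have hk2 := hpos (m + 2 + k)
    -- ratio monotonicity: h(m+2) h(m+1+k) ≤ h(m+1) h(m+2+k)
    have hr := ratio_step_mono hmono hb hlo hh hf (m + 1) k
    rw [show m + 1 + 1 = m + 2 by ring, show m + 1 + 1 + k = m + 2 + k by ring] at hr
    -- h(m+1+k) ≤ h(m+1)
    have hle : h (m + 1 + k) ≤ h (m + 1) := hanti (by omega)
    rw [div_mul_eq_mul_div, div_le_div_iff_of_pos_right (by norm_num : (0:ℝ) < 2)]
    rw [show L k * h (m + 1 + k) ^ 3 * (h (m + 2) / h (m + 1)) = L k * (h (m + 1 + k) ^ 2 * (h (m + 2) * h (m + 1 + k) / h (m + 1))) by ring,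
      show h (m + 1) ^ 2 * (L k * h (m + 2 + k)) = L k * (h (m + 1) ^ 2 * h (m + 2 + k)) by ring]
    refine mul_le_mul_of_nonneg_left ?_ (hL k)
    calc h (m + 1 + k) ^ 2 * (h (m + 2) * h (m + 1 + k) / h (m + 1)) ≤ h (m + 1) ^ 2 * (h (m + 2) * h (m + 1 + k) / h (m + 1)) :=
          mul_le_mul_of_nonneg_right (pow_le_pow_left₀ hk1.le hle 2) (by positivity)
      _ ≤ h (m + 1) ^ 2 * h (m + 2 + k) := by
          refine mul_le_mul_of_nonneg_left ?_ (by positivity)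
          rw [div_le_iff₀ h1]; linarith
  have hterm1 : (L 1 * h (m + 2) ^ 3 / 2) * (h (m + 1) / h (m + 2)) ≤ h (m + 1) ^ 2 * (L 1 * h (m + 2 + 1)) / 2 := by
    have hlc := log_concave_flow hmono hb hlo hh hf (m + 1)
    rw [show m + 1 + 1 = m + 2 by ring, show m + 1 + 2 = m + 2 + 1 by ring] at hlc
    rw [div_mul_eq_mul_div, div_le_div_iff_of_pos_right (by norm_num : (0:ℝ) < 2)]
    rw [show L 1 * h (m + 2) ^ 3 * (h (m + 1) / h (m + 2)) = L 1 * (h (m + 2) ^ 2 * h (m + 1)) by field_simp]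
    rw [show h (m + 1) ^ 2 * (L 1 * h (m + 2 + 1)) = L 1 * (h (m + 2 + 1) * h (m + 1) * h (m + 1)) by ring]
    exact mul_le_mul_of_nonneg_left (by nlinarith [hlc, h1]) (hL 1)
  -- assemble: split off k = 1 from both sums
  have h1K : 1 ∈ range K := mem_range.mpr hK
  have hsumF : ∑ k ∈ range K, L k * h (m + 1 + k) ^ 3 / 2 =
      L 1 * h (m + 2) ^ 3 / 2 + ∑ k ∈ (range K).erase 1, L k * h (m + 1 + k) ^ 3 / 2 := by
    rw [← add_sum_erase _ _ h1K]
  have hsumB : ∑ k ∈ range K, L k * h (m + 2 + k) = L 1 * h (m + 2 + 1) + ∑ k ∈ (range K).erase 1, L k * h (m + 2 + k) := by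
    rw [← add_sum_erase _ _ h1K]
  have hrest : (∑ k ∈ (range K).erase 1, L k * h (m + 1 + k) ^ 3 / 2) * (h (m + 2) / h (m + 1)) ≤
      h (m + 1) ^ 2 * (∑ k ∈ (range K).erase 1, L k * h (m + 2 + k)) / 2 := by
    rw [sum_mul, mul_sum, sum_div]
    exact sum_le_sum fun k _ => hterm k
  -- r² − 1 = h(m+1)² B ≥ h(m+1)² Σ
  set r := h (m + 1) / h (m + 2) with hr
  have hr0 : 0 < r := by positivity
  have hrinv : h (m + 2) / h (m + 1) = 1 / r := by rw [hr, one_div_div]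
  have hBeq : B (fun j => h (m + 2 + j)) = 1 / h (m + 2) ^ 2 - 1 / h (m + 1) ^ 2 := by linarith [e1]
  have hr2 : r ^ 2 - 1 = h (m + 1) ^ 2 * B (fun j => h (m + 2 + j)) := by
    rw [hBeq, hr, div_pow]
    field_simp
  have hrest' : (∑ k ∈ (range K).erase 1, L k * h (m + 1 + k) ^ 3 / 2) ≤
      r * (h (m + 1) ^ 2 * (∑ k ∈ (range K).erase 1, L k * h (m + 2 + k)) / 2) := by
    rw [hrinv] at hrest
    have := mul_le_mul_of_nonneg_left hrest hr0.le
    rwa [show r * ((∑ k ∈ (range K).erase 1, L k * h (m + 1 + k) ^ 3 / 2) * (1 / r)) =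
      ∑ k ∈ (range K).erase 1, L k * h (m + 1 + k) ^ 3 / 2 by field_simp] at this
  -- main chain, multiplied by r
  have hmain : 2 * (L 1 * h (m + 2) ^ 3 / 2) * r + 2 * (∑ k ∈ (range K).erase 1, L k * h (m + 1 + k) ^ 3 / 2) / r ≤ r ^ 2 - 1 := by
    rw [hr2, ← sub_nonneg]
    have eB : h (m + 1) ^ 2 * B (fun j => h (m + 2 + j)) ≥ h (m + 1) ^ 2 * (L 1 * h (m + 2 + 1)) + h (m + 1) ^ 2 * ∑ k ∈ (range K).erase 1, L k * h (m + 2 + k) := by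
      rw [← mul_add, ← hsumB]; exact mul_le_mul_of_nonneg_left hdomB (by positivity)
    have e2 : 2 * (∑ k ∈ (range K).erase 1, L k * h (m + 1 + k) ^ 3 / 2) / r ≤ h (m + 1) ^ 2 * ∑ k ∈ (range K).erase 1, L k * h (m + 2 + k) := by
      rw [div_le_iff₀ hr0]; nlinarith [hrest']
    nlinarith [hterm1, e2, eB]
  rw [hsumF, show L 1 * h (m + 2) ^ 3 / 2 + ∑ k ∈ (range K).erase 1, L k * h (m + 1 + k) ^ 3 / 2 - L 1 * h (m + 2) ^ 3 / 2 =
    ∑ k ∈ (range K).erase 1, L k * h (m + 1 + k) ^ 3 / 2 by ring]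
  have := mul_le_mul_of_nonneg_left hmain hr0.le
  have e3 : r * (2 * (L 1 * h (m + 2) ^ 3 / 2) * r + 2 * (∑ k ∈ (range K).erase 1, L k * h (m + 1 + k) ^ 3 / 2) / r) =
      2 * (L 1 * h (m + 2) ^ 3 / 2) * r ^ 2 + 2 * ∑ k ∈ (range K).erase 1, L k * h (m + 1 + k) ^ 3 / 2 := by
    field_simp
  rw [e3] at this
  nlinarith [this]

/-- **THE ONE-LAG DECAY ALONG THE FLOW.**  `B` isotone with floor `b > 0`, dominated by `L ≥ 0` on the ages `< K` (`1 < K`); `h` a box solution; `g` any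
damping with `1∕(1 + Σ_{k<K} L_kh_{t+k}³∕2) ≤ g_t ≤ 1`.  Then the one-lag young kernel `Kk_m = (L_1h_{m+1}³∕2)·g_{m+1}` satisfies
**`Kk_{m+1}·(1 + Kk_m) ≤ Kk_m`** at every pin `m` — the hypothesis `hdec` of (E80g) `one_lag_young_drops_antitone`. [folklore] -/
theorem one_lag_decay_flow (hmono : ∀ u v : ℕ → ℝ, SeqBox γ u → SeqBox γ v → (∀ j, u j ≤ v j) → B u ≤ B v) (hL : ∀ k, 0 ≤ L k) (hb : 0 < b)
    (hlo : ∀ u, SeqBox γ u → b ≤ B u) (hdom : ∀ u, SeqBox γ u → ∑ k ∈ range K, L k * u k ≤ B u)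
    (hh : SeqBox γ h) (hf : MemFlow B gIR h)
    (hg : ∀ t, 0 < g t ∧ g t ≤ 1) (hgF : ∀ t, 1 / (1 + ∑ k ∈ range K, L k * h (t + k) ^ 3 / 2) ≤ g t) (hK : 1 < K) (m : ℕ) :
    (L 1 * h (m + 2) ^ 3 / 2 * g (m + 2)) * (1 + L 1 * h (m + 1) ^ 3 / 2 * g (m + 1)) ≤ L 1 * h (m + 1) ^ 3 / 2 * g (m + 1) := by
  have hpos : ∀ n, 0 < h n := fun n => (hh n).1
  have hanti := (strictAnti_of_memFlow hb hlo hh hf).antitone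
  have h1 := hpos (m + 1); have h2 := hpos (m + 2)
  have hL1 := hL 1
  set c' := L 1 * h (m + 2) ^ 3 / 2 with hc'
  set c := L 1 * h (m + 1) ^ 3 / 2 with hc
  set F := ∑ k ∈ range K, L k * h (m + 1 + k) ^ 3 / 2 with hF
  set r := h (m + 1) / h (m + 2) with hr
  have hc'0 : 0 ≤ c' := by rw [hc']; positivity
  have hc0 : 0 ≤ c := by rw [hc]; positivity
  have hF0 : 0 ≤ F := by rw [hF]; exact sum_nonneg fun k _ => by have := hpos (m + 1 + k); have := hL k; positivity
  have hcF : c' ≤ F := by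
    have := single_le_sum (f := fun k => L k * h (m + 1 + k) ^ 3 / 2) (fun k _ => by have := hpos (m + 1 + k); have := hL k; positivity)
      (mem_range.mpr hK)
    simpa [hF, hc', show m + 1 + 1 = m + 2 by ring] using this
  have hr0 : 0 < r := by rw [hr]; positivity
  have hr1 : 1 ≤ r := by rw [hr, le_div_iff₀ h2, one_mul]; exact hanti (by omega)
  have hr2 : r ≤ 2 := by
    have hsq := sq_le_two_mul_sq hmono hb hlo hh hf m
    have : r ^ 2 ≤ 2 := by rw [hr, div_pow, div_le_iff₀ (by positivity)]; linarith
    nlinarith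
  have hflow := level_step_ge hmono hL hb hlo hdom hh hf hK m
  have hpoly := one_lag_poly hr1 hr2 hcF hflow
  -- c = c′ r³
  have hcc : c = c' * r ^ 3 := by rw [hc, hc', hr, div_pow]; field_simp
  -- the damping class at t = m+1 and t = m+2
  have hG := hgF (m + 1)
  have hG0 := (hg (m + 1)).1
  have hg2 := (hg (m + 2)).2
  have hg20 := (hg (m + 2)).1
  -- c′ g₂ (1 + c G) ≤ c′ (1 + c G) ≤ c G
  have step1 : c' * g (m + 2) * (1 + c * g (m + 1)) ≤ c' * (1 + c * g (m + 1)) := by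
    have : 0 ≤ c' * (1 + c * g (m + 1)) := by positivity
    nlinarith
  have step2 : c' * (1 + c * g (m + 1)) ≤ c * g (m + 1) := by
    -- G (1+F) ≥ 1 and c (1 − c′) = c′ r³ (1 − c′) ≥ c′ (1 + F)
    have hG1 : 1 ≤ g (m + 1) * (1 + F) := by
      rw [one_div_le (by positivity) hG0] at hG
      rw [← div_le_iff₀' hG0] ; simpa [one_div] using hG
    have hkey : c' * (1 + F) ≤ c * (1 - c') := by rw [hcc]; nlinarith [hpoly]
    nlinarith [mul_le_mul_of_nonneg_left hkey hG0.le, mul_nonneg hc'0 hF0]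
  exact step1.trans step2

/-- The young coefficient is at most `1∕√2 ≤ 1`: `L_1h_{m+1}³∕2 ≤ 1` (indeed `L_1h_{m+2}h_{m+1}² ≤ 1` from the level step and `h_{m+1}² ≤ 2h_{m+2}²`).
[folklore] -/
theorem young_coeff_le (hmono : ∀ u v : ℕ → ℝ, SeqBox γ u → SeqBox γ v → (∀ j, u j ≤ v j) → B u ≤ B v) (hL : ∀ k, 0 ≤ L k) (hb : 0 < b)
    (hlo : ∀ u, SeqBox γ u → b ≤ B u) (hdom : ∀ u, SeqBox γ u → ∑ k ∈ range K, L k * u k ≤ B u)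
    (hh : SeqBox γ h) (hf : MemFlow B gIR h) (hK : 1 < K) (m : ℕ) : L 1 * h (m + 1) ^ 3 / 2 ≤ 1 := by
  have hpos : ∀ n, 0 < h n := fun n => (hh n).1
  have h0 := hpos m; have h1 := hpos (m + 1); have h2 := hpos (m + 2)
  have e0 := hf.2 m
  have hdomB : ∑ k ∈ range K, L k * h (m + 1 + k) ≤ B (fun j => h (m + 1 + j)) := hdom _ (seqBox_shift hh (m + 1))
  have h1K : L 1 * h (m + 1 + 1) ≤ ∑ k ∈ range K, L k * h (m + 1 + k) :=
    single_le_sum (f := fun k => L k * h (m + 1 + k)) (fun k _ => mul_nonneg (hL k) (hpos _).le) (mem_range.mpr hK)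
  rw [show m + 1 + 1 = m + 2 by ring] at h1K
  -- L_1 h(m+2) ≤ 1/h(m+1)²
  have ha0 : 0 ≤ 1 / h m ^ 2 := by positivity
  have hstep : L 1 * h (m + 2) ≤ 1 / h (m + 1) ^ 2 := by linarith
  have hsq := sq_le_two_mul_sq hmono hb hlo hh hf m
  -- L_1 h(m+1)³ = L_1 h(m+2) h(m+1)² (h(m+1)/h(m+2)) ≤ 1 · √2-ish; we use h(m+1) ≤ √2 h(m+2) via squares
  have hA : L 1 * h (m + 2) * h (m + 1) ^ 2 ≤ 1 := by
    have := mul_le_mul_of_nonneg_right hstep (pow_nonneg h1.le 2)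
    rwa [one_div_mul_cancel (by positivity)] at this
  -- (L_1 h(m+1)³)² = (L_1 h(m+2) h(m+1)²)² (h(m+1)/h(m+2))² ≤ 1 · 2
  have hB : (L 1 * h (m + 1) ^ 3) ^ 2 ≤ 2 := by
    have hx : 0 ≤ L 1 * h (m + 2) * h (m + 1) ^ 2 := by have := hL 1; positivity
    have e : (L 1 * h (m + 1) ^ 3) ^ 2 * h (m + 2) ^ 2 = (L 1 * h (m + 2) * h (m + 1) ^ 2) ^ 2 * h (m + 1) ^ 2 := by ring
    have : (L 1 * h (m + 2) * h (m + 1) ^ 2) ^ 2 * h (m + 1) ^ 2 ≤ 1 * (2 * h (m + 2) ^ 2) :=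
      mul_le_mul (by nlinarith) hsq (by positivity) zero_le_one
    nlinarith [pow_pos h2 2]
  have hL1 := hL 1
  nlinarith [sq_nonneg (L 1 * h (m + 1) ^ 3 - 1), mul_nonneg hL1 (pow_nonneg h1.le 3)]

/-! ## §4 In the `KL` letters of (E80e)∕(E80f) -/

/-- **THE FLOW'S ONE-LAG YOUNG KERNEL DECAYS**: with (E80e)'s lone kernels `KL`, `KL 1 (m+1) 0 · (1 + KL 1 m 0) ≤ KL 1 m 0`. [folklore] -/
theorem kernel_one_lag_decay (hmono : ∀ u v : ℕ → ℝ, SeqBox γ u → SeqBox γ v → (∀ j, u j ≤ v j) → B u ≤ B v) (hL : ∀ k, 0 ≤ L k) (hb : 0 < b)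
    (hlo : ∀ u, SeqBox γ u → b ≤ B u) (hdom : ∀ u, SeqBox γ u → ∑ k ∈ range K, L k * u k ≤ B u)
    (hh : SeqBox γ h) (hf : MemFlow B gIR h)
    (hg : ∀ t, 0 < g t ∧ g t ≤ 1) (hgF : ∀ t, 1 / (1 + ∑ k ∈ range K, L k * h (t + k) ^ 3 / 2) ≤ g t) (hK : 2 ≤ K)
    {KL : ℕ → ℕ → ℕ → ℝ}
    (hKL : ∀ k n l, KL k n l = if 0 < k ∧ k < K ∧ l < k then L k * h (n + k) ^ 3 / 2 * ∏ t ∈ Ico (n + 1 + l) (n + k + 1), g t else 0) (m : ℕ) :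
    KL 1 (m + 1) 0 * (1 + KL 1 m 0) ≤ KL 1 m 0 := by
  have e : ∀ n, KL 1 n 0 = L 1 * h (n + 1) ^ 3 / 2 * g (n + 1) := fun n => by
    rw [hKL, if_pos ⟨Nat.one_pos, by omega, Nat.one_pos⟩, show n + 1 + 0 = n + 1 by ring, Nat.Ico_succ_singleton, prod_singleton]
  rw [e, e, show m + 1 + 1 = m + 2 by ring]
  exact one_lag_decay_flow hmono hL hb hlo hdom hh hf hg hgF (by omega) m

/-- The flow's one-lag young kernel lies in `[0, 1]`. [folklore] -/
theorem kernel_one_lag_le_one (hmono : ∀ u v : ℕ → ℝ, SeqBox γ u → SeqBox γ v → (∀ j, u j ≤ v j) → B u ≤ B v) (hL : ∀ k, 0 ≤ L k) (hb : 0 < b)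
    (hlo : ∀ u, SeqBox γ u → b ≤ B u) (hdom : ∀ u, SeqBox γ u → ∑ k ∈ range K, L k * u k ≤ B u)
    (hh : SeqBox γ h) (hf : MemFlow B gIR h) (hg : ∀ t, 0 < g t ∧ g t ≤ 1) (hK : 2 ≤ K)
    {KL : ℕ → ℕ → ℕ → ℝ}
    (hKL : ∀ k n l, KL k n l = if 0 < k ∧ k < K ∧ l < k then L k * h (n + k) ^ 3 / 2 * ∏ t ∈ Ico (n + 1 + l) (n + k + 1), g t else 0) (m : ℕ) :
    0 ≤ KL 1 m 0 ∧ KL 1 m 0 ≤ 1 := by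
  have e : KL 1 m 0 = L 1 * h (m + 1) ^ 3 / 2 * g (m + 1) := by
    rw [hKL, if_pos ⟨Nat.one_pos, by omega, Nat.one_pos⟩, show m + 1 + 0 = m + 1 by ring, Nat.Ico_succ_singleton, prod_singleton]
  have hc := young_coeff_le hmono hL hb hlo hdom hh hf (by omega) m
  have hc0 : 0 ≤ L 1 * h (m + 1) ^ 3 / 2 := by have := hL 1; have := (hh (m + 1)).1; positivity
  rw [e]
  exact ⟨mul_nonneg hc0 (hg _).1.le, by nlinarith [(hg (m + 1)).2, (hg (m + 1)).1]⟩

/-! ## §5 The single-age profile: route (N)'s first-order END with no monotonicity hypothesis -/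

/-- **ROUTE (N), FIRST ORDER, END FOR THE SINGLE-AGE FLOW — UNCONDITIONAL.**  (E80f) `flow_nonneg_of_mono2` at `K = 2` (the lone age `1`): `hMONOa` is
vacuous (`RA 2 = 0`) and `hMONO2` is (E80g) `one_lag_young_drops_antitone` fed by `kernel_one_lag_decay`; so for every box solution of an isotone memory with
floor dominated by `L` on the ages `< 2` and every damping in the relaxed class, the first-order comparison surplus is non-negative for every admissible
excess — NO monotonicity hypothesis left. [folklore] -/
theorem flow_nonneg_two (hmono : ∀ u v : ℕ → ℝ, SeqBox γ u → SeqBox γ v → (∀ j, u j ≤ v j) → B u ≤ B v)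
    (hL : ∀ k, 0 ≤ L k) (hb : 0 < b) (hlo : ∀ u, SeqBox γ u → b ≤ B u) (hdom : ∀ u, SeqBox γ u → ∑ k ∈ range 2, L k * u k ≤ B u)
    (hh : SeqBox γ h) (hf : MemFlow B gIR h)
    (hg : ∀ t, 0 < g t ∧ g t ≤ 1) (hgF : ∀ t, 1 / (1 + ∑ k ∈ range 2, L k * h (t + k) ^ 3 / 2) ≤ g t)
    {KL θ : ℕ → ℕ → ℕ → ℝ}
    (hKL : ∀ k n l, KL k n l = if 0 < k ∧ k < 2 ∧ l < k then L k * h (n + k) ^ 3 / 2 * ∏ t ∈ Ico (n + 1 + l) (n + k + 1), g t else 0)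
    (hθ : ∀ k n l, θ k n l = 1 - (h (n + k + l) / h (n + k)) ^ 3 * ∏ t ∈ Ico (n + k + 1) (n + k + l + 1), g t)
    {KA : ℕ → ℕ → ℕ → ℝ} {RL RA SL SA : ℕ → (ℕ → ℝ) → ℕ → ℝ}
    (hRL : ∀ i v m, RL i v m = ∑ l ∈ range 2, KL i m l * v (m + 1 + l))
    (hRA : ∀ i v m, RA i v m = ∑ l ∈ range 2, KA i m l * v (m + 1 + l))
    (hKA : ∀ i m l, KA i m l = KL i m l + KA (i + 1) m l) (hKAtop : ∀ m l, KA 2 m l = 0)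
    (hSL : ∀ i (w : ℕ → ℝ), (∀ m, 2 < m → w m = 0) → (∀ m, 2 < m → SL i w m = 0) ∧ ∀ m, SL i w m = w m - RL i (SL i w) m)
    (hSA : ∀ i (w : ℕ → ℝ), (∀ m, 2 < m → w m = 0) → (∀ m, 2 < m → SA i w m = 0) ∧ ∀ m, SA i w m = w m - RA i (SA i w) m)
    {e ε : ℕ → ℝ} (he0 : ∀ m, 0 ≤ e m) (hea : ∀ m, e (m + 1) ≤ e m) (het : ∀ m, 2 < m → e m = 0)
    (hεt : ∀ m, 2 < m → ε m = 0) (hεrec : ∀ m, ε m = e m - RA 1 ε m) : ∀ m, 0 ≤ ε m := by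
  -- RA 2 = 0, SA 2 = id
  have hRA2 : ∀ v m, RA 2 v m = 0 := fun v m => by rw [hRA]; exact sum_eq_zero fun l _ => by rw [hKAtop, zero_mul]
  have hSA2 : ∀ w : ℕ → ℝ, (∀ m, 2 < m → w m = 0) → ∀ m, SA 2 w m = w m :=
    fun w hw => aggregate_sol_top (N := 2) (n := 1) hRA hKAtop hSA hw
  -- the one-lag reads of age 1
  have hRL1 : ∀ v m, RL 1 v m = KL 1 m 0 * v (m + 1) := fun v m => by
    rw [hRL, sum_range_succ, sum_range_one, show m + 1 + 0 = m + 1 by ring]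
    have : KL 1 m 1 = 0 := by rw [hKL, if_neg (by omega)]
    rw [this, zero_mul, add_zero]
  have hdec := kernel_one_lag_decay hmono hL hb hlo hdom hh hf hg hgF le_rfl hKL
  have hK01 := kernel_one_lag_le_one hmono hL hb hlo hdom hh hf hg le_rfl hKL
  refine flow_nonneg_of_mono2 hmono hL hb hlo hdom hh hf hg hgF le_rfl hKL hθ hRL hRA hKA hKAtop hSL hSA ?_ ?_ he0 hea het hεt hεrec
  · -- hMONOa: i = 1, RA 2 ≡ 0
    intro i hi1 hi2 w _ _ _ m
    have hi : i = 1 := by omega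
    subst hi
    rw [hRA2, hRA2]
  · -- hMONO2: i = 1, SA 2 w = w, (E80g)
    intro i hi1 hi2 w hw0 hwa hwt m
    have hi : i = 1 := by omega
    subst hi
    have hv : SA 2 w = w := funext (hSA2 w hwt)
    rw [hv]
    set t := SL 1 w with ht
    have htt := (hSL 1 w hwt).1
    have htrec : ∀ m, t m = w m - KL 1 m 0 * t (m + 1) := fun m => by rw [← hRL1]; exact (hSL 1 w hwt).2 m
    rw [hRL1, hRL1, show m + 1 + 1 = m + 2 by ring]
    exact one_lag_young_drops_antitone (Kk := fun m => KL 1 m 0) (fun m => (hK01 m).1) (fun m => (hK01 m).2) hdec hw0 hwa hwt htt htrec m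

end Summit.QuantumFields.BalabanUV.Beta.EriceRemainderEnclosureHistoryAutonomyComparisonAgeCompositionOneLagDecayFlow

end
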